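import Literature.MathematicalPhysics.QuantumLattice.PeriodicStatesMeanEntropy
import Literature.MathematicalPhysics.QuantumLattice.VariationalPressureBoxPartitionFunctionBound
import HarnessLib

/-!
# The periodic variational pressure `P_q(β,Ψ) = sup_{ω q-periodic} [s̄(ω) − β ē_q(ω)]` of a superlattice-periodic interaction:
# trial principle, convexity, the finite-volume CAP from one aligned box, and agreement with the translation-invariant pressure

Topic `Literature/MathematicalPhysics/QuantumLattice` (family `hubbard`; crew hubbard-fast S2/S3 «T > 0 for decorated / multi-band / stacked / staggered
models»). The translation-invariant theory (`TIVariationalPressure`: `P(β,Ψ) = sup_{ω TI}[s̄ − βe_Ψ]`) does not cover interactions covariant only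
under a superlattice `L_q = ⊕_i (q_i+1)ℤe_i` (`FermionInteraction.IsPeriodic q`, `PeriodicInteractionsCellEnergy`). For those the natural variational
problem runs over `q`-PERIODIC states with the CELL energy density `ē_q(ω) = cellMeanEnergy q Ψ ω R` and the mean entropy `s̄(ω) = entropyDensitySup ω`
(the limit of `S(ω|_{[0,n)^d})/n^d` along aligned boxes, `PeriodicStatesMeanEntropy`):

* §1 `FermionInteraction.perVarPressure β q Ψ R` (`P_q`): trial principle `sub_mul_le_perVarPressure`, least-bound reading `perVarPressure_le`,
  `exists_lt_of_lt_perVarPressure`, a-priori window, CONVEXITY in `β` (`convexOn_perVarPressure_beta`).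
* §2 **THE CAP FROM ONE ALIGNED BOX** (periodic twin of `varPressure_le_log_partitionFn_box`): for `Ψ` Hermitian, `q`-periodic of finite range `R`
  with uniform site norm `S`, `d ≥ 1`, every real `β` and every ALIGNED `n ≥ 1` (`(q_i+1) ∣ n`):
  `n^d · P_q(β,Ψ) ≤ log Re Tr e^{−βH_{[0,n)^d}} + β Re(Ψ∅)_{∅∅} + |β| · |thicken_R([0,n)^d) ∖ [0,n)^d| · S` (`perVarPressure_le_log_partitionFn_box`).
* §3 CONSISTENCY: for a translation-COVARIANT `Ψ`, `P_q(β,Ψ) = P(β,Ψ)` for every `q` (`perVarPressure_eq_varPressure`): the cell average of a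
  periodic state is translation invariant with the same cell energy and NOT SMALLER mean entropy (`IsPeriodic.entropyDensitySup_le_cellAverage`,
  concavity + aligned-box comparisons).

Everything is PROVED; definition with body: `FermionInteraction.perVarPressure`; no named fact, no number. The FLOOR / variational principle for
periodic interactions (`P_q = lim` of aligned box pressures) is the sequel `PeriodicGibbsVariationalPrinciple`.

## Tree / Mathlib search

REUSED: `IsPeriodic` (states), `cellAverage`, `isTranslationInvariant_cellAverage`, `shiftAverage_expect` (`PeriodicStatesCellAverage`);
`cellMeanEnergy`, `abs_cellMeanEnergy_le`, `cellMeanEnergy_eq_meanEnergy_cellAverage`, `IsTranslationInvariant.cellMeanEnergy_eq`,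
`IsPeriodic.abs_pow_mul_cellMeanEnergy_sub_le`, `superlatVec` (`PeriodicInteractionsCellEnergy`); `IsPeriodic.isEven`,
`IsPeriodic.entropyDensitySup_le_boxEntropyDensity`, `IsPeriodic.tendsto_boxEntropyDensity_aligned`, `IsPeriodic.vonNeumannEntropy_rdm_shiftSet_superlatVec`
(`PeriodicStatesMeanEntropy`); `entropyDensitySup(_le/_nonneg)`, `varPressure`, `sub_mul_le_varPressure`, `varPressure_le`, `boxEntropyDensity`
(`TIVariationalPressure`); `le_vonNeumannEntropy_rdm_shiftAverage` pattern via `vonNeumannEntropy_convexComb_ge`; `vonNeumannEntropy_le_sum_regionEntropy_add`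
(`FermionBoxSubadditivity`); `IsHermitian.vonNeumannEntropy_sub_mul_le_log_partitionFn` (`GibbsVariationalPrinciple`).

## References

* R. B. Israel, *Convexity in the Theory of Lattice Gases* (1979), §I.1–I.2 (periodic interactions through the sublattice), Thm. II.3.1.
  [cite: Israel1979, Thm. I.2.4]
* O. Bratteli, D. W. Robinson, *OAQSM 2* (1997), Thm. 6.2.40, Prop. 6.2.38. [cite: BratteliRobinsonII1997, Thm. 6.2.40]
* H. Araki, H. Moriya, Rev. Math. Phys. 15 (2003) 93, §8 (periodic potentials), §10–§11. [cite: ArakiMoriya2003, Theorem 3.8 and §10]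
-/

noncomputable section

open scoped ComplexOrder BigOperators Matrix.Norms.L2Operator
open Finset Literature.InformationTheory.Entropy

namespace Literature.MathematicalPhysics.QuantumLattice

open Matrix HubbardWave0 Literature.Probability.LatticeModels ThermodynamicLimit
open _root_.Filter
open scoped _root_.Topology

variable {d : ℕ}

/-! ### §1. The periodic variational pressure -/

namespace FermionInteraction

/-- The cell site-norm constant `S_q(Ψ,R) = max_{c ∈ C} Σ_{X ∋ pos c, X ⊆ thicken{pos c} R} ‖Ψ X‖` (a uniform site norm for `q`-periodic `Ψ`).
[cite: ArakiMoriya2003, §5.4 (finite range potentials)] -/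
def cellSiteNorm (q : Fin d → ℕ) (Ψ : FermionInteraction d) (R : ℝ) : ℝ :=
  Finset.univ.sup' Finset.univ_nonempty fun c : Cell q =>
    ∑ X ∈ (thicken ({cellPos c} : Finset (Site d)) R).powerset with cellPos c ∈ X, ‖Ψ.Φ X‖

/-- The site norm at a cell point is at most `S_q`. [cite: ArakiMoriya2003, §5.4] -/
theorem site_norm_cellPos_le_cellSiteNorm (q : Fin d → ℕ) (Ψ : FermionInteraction d) (R : ℝ) (c : Cell q) :
    ∑ X ∈ (thicken ({cellPos c} : Finset (Site d)) R).powerset with cellPos c ∈ X, ‖Ψ.Φ X‖ ≤ Ψ.cellSiteNorm q R :=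
  Finset.le_sup' (fun c : Cell q => ∑ X ∈ (thicken ({cellPos c} : Finset (Site d)) R).powerset with cellPos c ∈ X, ‖Ψ.Φ X‖) (Finset.mem_univ c)

/-- For a `q`-periodic interaction `S_q` is a uniform site norm. [cite: ArakiMoriya2003, §5.4] -/
theorem IsPeriodic.site_norm_le_cellSiteNorm {q : Fin d → ℕ} {Ψ : FermionInteraction d} (hΨ : Ψ.IsPeriodic q) (R : ℝ) (y : Site d) :
    ∑ X ∈ (thicken ({y} : Finset (Site d)) R).powerset with y ∈ X, ‖Ψ.Φ X‖ ≤ Ψ.cellSiteNorm q R :=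
  hΨ.site_norm_le y

/-- **THE PERIODIC VARIATIONAL PRESSURE** `P_q(β,Ψ) = sup {s̄(ω) − β ē_q(ω) : ω q-periodic}` (`s̄ = entropyDensitySup`, `ē_q = cellMeanEnergy`).
[cite: Israel1979, Thm. I.2.4] [cite: ArakiMoriya2003, Theorem 3.8 and §10] -/
def perVarPressure (β : ℝ) (q : Fin d → ℕ) (Ψ : FermionInteraction d) (R : ℝ) : ℝ :=
  sSup ((fun ω : InfVolFermionState d => ω.entropyDensitySup - β * InfVolFermionState.cellMeanEnergy q Ψ ω R) ''
    {ω : InfVolFermionState d | ω.IsPeriodic q})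

variable (β : ℝ) (q : Fin d → ℕ) (Ψ : FermionInteraction d) (R : ℝ)

/-- `|ē_q(ω)| ≤ S_q` for every state. [cite: BratteliRobinsonI1987, Prop. 2.3.11] -/
theorem abs_cellMeanEnergy_le_cellSiteNorm (ω : InfVolFermionState d) :
    |InfVolFermionState.cellMeanEnergy q Ψ ω R| ≤ Ψ.cellSiteNorm q R := by
  have hN : (0 : ℝ) < Fintype.card (Cell q) := by exact_mod_cast Fintype.card_pos
  rw [InfVolFermionState.cellMeanEnergy, abs_mul, abs_of_pos (inv_pos.2 hN), ← div_eq_inv_mul, div_le_iff₀ hN]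
  calc |∑ c : Cell q, (InfVolFermionState.siteEnergy Ψ ω R (cellPos c)).re| ≤ ∑ c : Cell q, |(InfVolFermionState.siteEnergy Ψ ω R (cellPos c)).re| :=
        Finset.abs_sum_le_sum_abs _ _
    _ ≤ ∑ _c : Cell q, Ψ.cellSiteNorm q R := Finset.sum_le_sum fun c _ =>
        (Complex.abs_re_le_norm _).trans (InfVolFermionState.norm_siteEnergy_le (Ψ.site_norm_cellPos_le_cellSiteNorm q R c))
    _ = Ψ.cellSiteNorm q R * Fintype.card (Cell q) := by rw [Finset.sum_const, Finset.card_univ, nsmul_eq_mul, mul_comm]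

/-- The periodic variational functional is bounded above by `2 log 2 + |β| S_q`. [cite: BratteliRobinsonI1987, Prop. 2.3.11] -/
theorem bddAbove_perVarFunctional_image :
    BddAbove ((fun ω : InfVolFermionState d => ω.entropyDensitySup - β * InfVolFermionState.cellMeanEnergy q Ψ ω R) ''
      {ω : InfVolFermionState d | ω.IsPeriodic q}) := by
  refine ⟨2 * Real.log 2 + |β| * Ψ.cellSiteNorm q R, ?_⟩
  rintro _ ⟨ω, -, rfl⟩
  have h1 := ω.entropyDensitySup_le
  have h2 : -(β * InfVolFermionState.cellMeanEnergy q Ψ ω R) ≤ |β| * Ψ.cellSiteNorm q R := by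
    calc -(β * InfVolFermionState.cellMeanEnergy q Ψ ω R) ≤ |β * InfVolFermionState.cellMeanEnergy q Ψ ω R| := neg_le_abs _
      _ = |β| * |InfVolFermionState.cellMeanEnergy q Ψ ω R| := abs_mul _ _
      _ ≤ |β| * Ψ.cellSiteNorm q R := mul_le_mul_of_nonneg_left (Ψ.abs_cellMeanEnergy_le_cellSiteNorm q R ω) (abs_nonneg β)
  linarith

/-- The image set is non-empty (the vacuum is translation invariant, hence periodic). [cite: ArakiMoriya2003, §4.1 Def. 4.5] -/
theorem perVarFunctional_image_nonempty :
    ((fun ω : InfVolFermionState d => ω.entropyDensitySup - β * InfVolFermionState.cellMeanEnergy q Ψ ω R) ''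
      {ω : InfVolFermionState d | ω.IsPeriodic q}).Nonempty :=
  ⟨_, Set.mem_image_of_mem _ ((InfVolFermionState.vacuumState_isTranslationInvariant (d := d)).isPeriodic q)⟩

/-- **THE TRIAL PRINCIPLE**: `s̄(ω) − β ē_q(ω) ≤ P_q(β,Ψ)` for every `q`-periodic state. [cite: Israel1979, Thm. I.2.4] -/
theorem sub_mul_le_perVarPressure {ω : InfVolFermionState d} (hω : ω.IsPeriodic q) :
    ω.entropyDensitySup - β * InfVolFermionState.cellMeanEnergy q Ψ ω R ≤ Ψ.perVarPressure β q R :=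
  le_csSup (Ψ.bddAbove_perVarFunctional_image β q R) (Set.mem_image_of_mem _ hω)

/-- **`P_q` is the least such bound.** [cite: Israel1979, Thm. I.2.4] -/
theorem perVarPressure_le {c : ℝ}
    (h : ∀ ω : InfVolFermionState d, ω.IsPeriodic q → ω.entropyDensitySup - β * InfVolFermionState.cellMeanEnergy q Ψ ω R ≤ c) :
    Ψ.perVarPressure β q R ≤ c :=
  csSup_le (Ψ.perVarFunctional_image_nonempty β q R) (by
    rintro _ ⟨ω, hω, rfl⟩
    exact h ω hω)

/-- If `c < P_q` some periodic state beats `c`. [cite: Israel1979, Thm. I.2.4] -/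
theorem exists_lt_of_lt_perVarPressure {c : ℝ} (h : c < Ψ.perVarPressure β q R) :
    ∃ ω : InfVolFermionState d, ω.IsPeriodic q ∧ c < ω.entropyDensitySup - β * InfVolFermionState.cellMeanEnergy q Ψ ω R := by
  obtain ⟨_, ⟨ω, hω, rfl⟩, hlt⟩ := (lt_csSup_iff (Ψ.bddAbove_perVarFunctional_image β q R) (Ψ.perVarFunctional_image_nonempty β q R)).1 h
  exact ⟨ω, hω, hlt⟩

/-- A-priori window: `−|β| S_q ≤ P_q(β,Ψ) ≤ 2 log 2 + |β| S_q`. [cite: BratteliRobinsonI1987, Prop. 2.3.11] -/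
theorem perVarPressure_mem_Icc :
    Ψ.perVarPressure β q R ∈ Set.Icc (-(|β| * Ψ.cellSiteNorm q R)) (2 * Real.log 2 + |β| * Ψ.cellSiteNorm q R) := by
  constructor
  · have hv := (InfVolFermionState.vacuumState_isTranslationInvariant (d := d)).isPeriodic q
    have h := Ψ.sub_mul_le_perVarPressure β q R hv
    have h0 := (vacuumState d).entropyDensitySup_nonneg
    have h2 : β * InfVolFermionState.cellMeanEnergy q Ψ (vacuumState d) R ≤ |β| * Ψ.cellSiteNorm q R := by
      calc β * InfVolFermionState.cellMeanEnergy q Ψ (vacuumState d) R ≤ |β * InfVolFermionState.cellMeanEnergy q Ψ (vacuumState d) R| :=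
            le_abs_self _
        _ = |β| * |InfVolFermionState.cellMeanEnergy q Ψ (vacuumState d) R| := abs_mul _ _
        _ ≤ |β| * Ψ.cellSiteNorm q R := mul_le_mul_of_nonneg_left (Ψ.abs_cellMeanEnergy_le_cellSiteNorm q R _) (abs_nonneg β)
    linarith
  · refine Ψ.perVarPressure_le β q R fun ω _ => ?_
    have h1 := ω.entropyDensitySup_le
    have h2 : -(β * InfVolFermionState.cellMeanEnergy q Ψ ω R) ≤ |β| * Ψ.cellSiteNorm q R := by
      calc -(β * InfVolFermionState.cellMeanEnergy q Ψ ω R) ≤ |β * InfVolFermionState.cellMeanEnergy q Ψ ω R| := neg_le_abs _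
        _ = |β| * |InfVolFermionState.cellMeanEnergy q Ψ ω R| := abs_mul _ _
        _ ≤ |β| * Ψ.cellSiteNorm q R := mul_le_mul_of_nonneg_left (Ψ.abs_cellMeanEnergy_le_cellSiteNorm q R ω) (abs_nonneg β)
    linarith

/-- **`P_q(·,Ψ)` is CONVEX in `β`** (a supremum of affine functions). [cite: Israel1979, Thm. I.2.4] -/
theorem convexOn_perVarPressure_beta : ConvexOn ℝ Set.univ fun β : ℝ => Ψ.perVarPressure β q R := by
  refine ⟨convex_univ, fun x _ y _ a b ha hb hab => ?_⟩
  refine Ψ.perVarPressure_le _ q R fun ω hω => ?_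
  have hx := Ψ.sub_mul_le_perVarPressure x q R hω
  have hy := Ψ.sub_mul_le_perVarPressure y q R hω
  have e : ω.entropyDensitySup - (a • x + b • y) * InfVolFermionState.cellMeanEnergy q Ψ ω R =
      a * (ω.entropyDensitySup - x * InfVolFermionState.cellMeanEnergy q Ψ ω R) +
        b * (ω.entropyDensitySup - y * InfVolFermionState.cellMeanEnergy q Ψ ω R) := by
    simp only [smul_eq_mul]
    linear_combination (-ω.entropyDensitySup) * hab
  rw [e, smul_eq_mul, smul_eq_mul]
  exact add_le_add (mul_le_mul_of_nonneg_left hx ha) (mul_le_mul_of_nonneg_left hy hb)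

/-! ### §2. The cap from one aligned box -/

variable {β q Ψ R}

/-- **ONE ALIGNED BOX CAPS THE PERIODIC VARIATIONAL FUNCTIONAL**: for `Ψ` Hermitian, `q`-periodic, of finite range `R` with uniform site norm `S`
(`d ≥ 1`), a `q`-periodic `ω`, every real `β` and every aligned `n ≥ 1`:
`n^d (s̄(ω) − β ē_q(ω)) ≤ log Re Tr e^{−βH_{[0,n)^d}} + β Re(Ψ∅)_{∅∅} + |β| |thicken_R([0,n)^d) ∖ [0,n)^d| S`.
[cite: Israel1979, Lemma II.3.1] [cite: BratteliRobinsonII1997, Thm. 6.2.40] -/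
theorem _root_.Literature.MathematicalPhysics.QuantumLattice.InfVolFermionState.IsPeriodic.pow_mul_sub_mul_le_log_partitionFn_add (hd : 0 < d)
    (hH : Ψ.IsHermitian) (hΨ : Ψ.IsPeriodic q) (hR : Ψ.HasFiniteRange R) {S : ℝ}
    (hS : ∀ y : Site d, ∑ X ∈ (thicken ({y} : Finset (Site d)) R).powerset with y ∈ X, ‖Ψ.Φ X‖ ≤ S) (β : ℝ)
    {ω : InfVolFermionState d} (hω : ω.IsPeriodic q) {n : ℕ} (hn : 1 ≤ n) (hnq : ∀ i, (q i + 1) ∣ n) :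
    (n : ℝ) ^ d * (ω.entropyDensitySup - β * InfVolFermionState.cellMeanEnergy q Ψ ω R) ≤
      Real.log (Matrix.partitionFn β (Ψ.localHamiltonian (halfOpenBox d n))).re + β * ((Ψ.Φ ∅) ∅ ∅).re +
        |β| * ((((thicken (halfOpenBox d n) R \ halfOpenBox d n).card : ℝ)) * S) := by
  set B := halfOpenBox d n with hB
  have hG := (localHamiltonian_isHermitian hH B).vonNeumannEntropy_sub_mul_le_log_partitionFn β (ω.rdm_posSemidef B) (ω.trace_rdm B)
  rw [InfVolFermionState.trace_rdm_mul] at hG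
  have hSle := hω.entropyDensitySup_le_boxEntropyDensity hd hn hnq
  rw [InfVolFermionState.boxEntropyDensity_apply, le_div_iff₀ (by positivity)] at hSle
  have hE := hω.abs_pow_mul_cellMeanEnergy_sub_le hΨ hR hS hnq
  rw [← hB] at hE hSle
  rw [abs_le] at hE
  set col : ℝ := (((thicken B R \ B).card : ℝ)) * S with hcol
  have hβE : -(β * ((n : ℝ) ^ d * InfVolFermionState.cellMeanEnergy q Ψ ω R)) ≤
      -(β * (ω.expect B (Ψ.localHamiltonian B)).re) + β * ((Ψ.Φ ∅) ∅ ∅).re + |β| * col := by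
    rcases le_or_gt 0 β with hb | hb
    · rw [abs_of_nonneg hb]
      have h := mul_le_mul_of_nonneg_left hE.1 hb
      linarith
    · rw [abs_of_neg hb]
      have h := mul_le_mul_of_nonneg_left hE.2 (neg_nonneg.2 hb.le)
      linarith
  linarith [hG, hSle, hβE]

/-- **THE CAP FROM ONE ALIGNED BOX**: `n^d · P_q(β,Ψ) ≤ log Re Tr e^{−βH_{[0,n)^d}} + β Re(Ψ∅)_{∅∅} + |β|·col_R(n)·S` for every aligned `n ≥ 1`
(`Ψ` Hermitian, `q`-periodic of finite range `R` with uniform site norm `S`; `d ≥ 1`; every real `β`). [cite: Israel1979, Lemma II.3.1]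
[cite: BratteliRobinsonII1997, Thm. 6.2.40] -/
theorem perVarPressure_le_log_partitionFn_box (hd : 0 < d) (hH : Ψ.IsHermitian) (hΨ : Ψ.IsPeriodic q) (hR : Ψ.HasFiniteRange R) {S : ℝ}
    (hS : ∀ y : Site d, ∑ X ∈ (thicken ({y} : Finset (Site d)) R).powerset with y ∈ X, ‖Ψ.Φ X‖ ≤ S) (β : ℝ) {n : ℕ} (hn : 1 ≤ n)
    (hnq : ∀ i, (q i + 1) ∣ n) :
    (n : ℝ) ^ d * Ψ.perVarPressure β q R ≤
      Real.log (Matrix.partitionFn β (Ψ.localHamiltonian (halfOpenBox d n))).re + β * ((Ψ.Φ ∅) ∅ ∅).re +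
        |β| * ((((thicken (halfOpenBox d n) R \ halfOpenBox d n).card : ℝ)) * S) := by
  have hnd : (0 : ℝ) < (n : ℝ) ^ d := by positivity
  rw [← le_div_iff₀' hnd]
  refine Ψ.perVarPressure_le β q R fun ω hω => ?_
  rw [le_div_iff₀' hnd]
  exact hω.pow_mul_sub_mul_le_log_partitionFn_add hd hH hΨ hR hS β hn hnq

/-- Certificate form with the cell site norm `S_q`: a certified UPPER bound `log Re Z_n ≤ u` on one aligned box caps `P_q`.
[cite: Israel1979, Lemma II.3.1] -/
theorem perVarPressure_le_of_log_partitionFn_le (hd : 0 < d) (hH : Ψ.IsHermitian) (hΨ : Ψ.IsPeriodic q) (hR : Ψ.HasFiniteRange R) (β : ℝ)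
    {n : ℕ} (hn : 1 ≤ n) (hnq : ∀ i, (q i + 1) ∣ n) {u : ℝ} (hu : Real.log (Matrix.partitionFn β (Ψ.localHamiltonian (halfOpenBox d n))).re ≤ u) :
    Ψ.perVarPressure β q R ≤ (u + β * ((Ψ.Φ ∅) ∅ ∅).re) / (n : ℝ) ^ d +
      |β| * ((((thicken (halfOpenBox d n) R \ halfOpenBox d n).card : ℝ)) * Ψ.cellSiteNorm q R) / (n : ℝ) ^ d := by
  have h := Ψ.perVarPressure_le_log_partitionFn_box hd hH hΨ hR (hΨ.site_norm_le_cellSiteNorm R) β hn hnq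
  have hnd : (0 : ℝ) < (n : ℝ) ^ d := by positivity
  rw [← add_div, le_div_iff₀' hnd]
  linarith

end FermionInteraction

/-! ### §3. Consistency with the translation-invariant variational pressure -/

namespace InfVolFermionState

variable {q : Fin d → ℕ} {ω : InfVolFermionState d}

/-- The product of the periods `L = Π_i (q_i+1)` is a common multiple. [cite: ArakiMoriya2003, §4.1] -/
theorem dvd_prod_succ (q : Fin d → ℕ) (i : Fin d) : (q i + 1) ∣ ∏ j, (q j + 1) :=
  Finset.dvd_prod_of_mem (fun j => q j + 1) (Finset.mem_univ i)

/-- A cell point shifted by `[0,n)^d` stays in `[0, n + L)^d`, `L = Π_i(q_i+1)`. [cite: ArakiMoriya2003, §4.1] -/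
theorem shiftSet_cellPos_halfOpenBox_subset (c : Cell q) (n : ℕ) :
    shiftSet (cellPos c) (halfOpenBox d n) ⊆ halfOpenBox d (n + ∏ j, (q j + 1)) := by
  intro x hx
  rw [mem_shiftSet, mem_halfOpenBox] at hx
  rw [mem_halfOpenBox]
  intro i
  obtain ⟨h1, h2⟩ := hx i
  have hc : ((c i : ℕ) : ℤ) ≤ q i := by exact_mod_cast Nat.lt_succ_iff.1 (c i).isLt
  have hL : q i + 1 ≤ ∏ j, (q j + 1) := Nat.le_of_dvd (Finset.prod_pos fun j _ => Nat.succ_pos _) (dvd_prod_succ q i)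
  simp only [Pi.sub_apply, cellPos] at h1 h2
  constructor
  · linarith [Int.natCast_nonneg (c i : ℕ)]
  · push_cast
    have : ((q i + 1 : ℕ) : ℤ) ≤ ((∏ j, (q j + 1) : ℕ) : ℤ) := by exact_mod_cast hL
    push_cast at this
    linarith

/-- **The translates of an aligned box have almost the entropy of the next aligned box**: for `q`-periodic `ω`, aligned `n` and a cell point `c`,
`S(ω|_{[0,n)^d + pos c}) ≥ S(ω|_{[0,n+L)^d}) − ((n+L)^d − n^d) log 4` (`L = Π_i(q_i+1)`; subadditivity on the bigger box).
[cite: ArakiMoriya2003, Theorem 3.8 and §10] -/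
theorem IsPeriodic.vonNeumannEntropy_rdm_shiftSet_cellPos_ge (hd : 0 < d) (hω : ω.IsPeriodic q) (c : Cell q) (n : ℕ) :
    vonNeumannEntropy (ω.rdm (halfOpenBox d (n + ∏ j, (q j + 1)))) -
        (((n : ℝ) + (∏ j, (q j + 1) : ℕ)) ^ d - (n : ℝ) ^ d) * Real.log 4 ≤
      vonNeumannEntropy (ω.rdm (shiftSet (cellPos c) (halfOpenBox d n))) := by
  set N := n + ∏ j, (q j + 1) with hN
  have hev : parityAut (ω.rdm (halfOpenBox d N)) = ω.rdm (halfOpenBox d N) := (hω.isEven hd).parityAut_rdm _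
  have h := vonNeumannEntropy_le_sum_regionEntropy_add ({c} : Finset (Cell q))
    (fun c' : Cell q => shiftSet (cellPos c') (halfOpenBox d n))
    (fun c' _ => shiftSet_cellPos_halfOpenBox_subset c' n) (fun a ha b hb hab => absurd ((Finset.mem_singleton.1 ha).trans (Finset.mem_singleton.1 hb).symm) hab)
    (ω.rdm_posSemidef _) (ω.trace_rdm _) hev
  rw [Finset.sum_singleton, Finset.sum_singleton, ω.regionEntropy_rdm (shiftSet_cellPos_halfOpenBox_subset c n), card_halfOpenBox,
    card_shiftSet_halfOpenBox] at h
  push_cast at h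
  rw [hN]
  push_cast
  linarith

/-- **THE CELL AVERAGE HAS AT LEAST THE MEAN ENTROPY OF THE PERIODIC STATE**: `s̄(ω) ≤ s̄(ω̄)` for `q`-periodic `ω` (`d ≥ 1`)
(concavity of the box entropies of the average + the previous comparison + the aligned-box limits). [cite: BratteliRobinsonII1997, Thm. 6.2.40]
[cite: ArakiMoriya2003, Theorem 3.8 and §10] -/
theorem IsPeriodic.entropyDensitySup_le_cellAverage (hd : 0 < d) (hω : ω.IsPeriodic q) :
    ω.entropyDensitySup ≤ (ω.cellAverage q).entropyDensitySup := by
  classical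
  set L := ∏ j, (q j + 1) with hL
  have hL1 : 1 ≤ L := Finset.prod_pos fun j _ => Nat.succ_pos _
  have hLq : ∀ i, (q i + 1) ∣ L := dvd_prod_succ q
  have hTI := hω.isTranslationInvariant_cellAverage
  -- along the aligned boxes `kL`: both entropy densities converge
  have hlimω : Tendsto (fun k : ℕ => ω.boxEntropyDensity (k * L + L)) atTop (𝓝 ω.entropyDensitySup) := by
    have h := hω.tendsto_boxEntropyDensity_mul hd hL1 hLq
    exact h.comp (tendsto_add_atTop_nat 1) |>.congr fun k => by simp [add_mul]
  have hlimA : Tendsto (fun k : ℕ => (ω.cellAverage q).boxEntropyDensity (k * L)) atTop (𝓝 (ω.cellAverage q).entropyDensitySup) :=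
    hTI.tendsto_boxEntropyDensity_mul hd hL1
  -- the correction `((kL+L)^d − (kL)^d) log 4/(kL)^d → 0` and the ratio `((kL+L)/(kL))^d → 1`
  have hcorr : Tendsto (fun k : ℕ => ((((k : ℝ) * L + L) ^ d - ((k : ℝ) * L) ^ d) * Real.log 4) / ((k : ℝ) * L) ^ d) atTop (𝓝 0) := by
    have h1 : Tendsto (fun k : ℕ => (((k : ℝ) * L + L) / ((k : ℝ) * L))) atTop (𝓝 1) := by
      have : Tendsto (fun k : ℕ => 1 + (1 : ℝ) / k) atTop (𝓝 (1 + 0)) := tendsto_const_nhds.add (tendsto_const_div_atTop_nhds_zero_nat _)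
      rw [add_zero] at this
      refine this.congr' ?_
      filter_upwards [Filter.eventually_ge_atTop 1] with k hk
      have hk0 : (k : ℝ) ≠ 0 := by exact_mod_cast (by omega : k ≠ 0)
      have hL0 : (L : ℝ) ≠ 0 := by exact_mod_cast (by omega : L ≠ 0)
      field_simp
    have h2 := ((h1.pow d).sub (tendsto_const_nhds (x := (1 : ℝ)))).mul_const (Real.log 4)
    rw [one_pow, sub_self, zero_mul] at h2
    refine h2.congr' ?_
    filter_upwards [Filter.eventually_ge_atTop 1] with k hk
    have hk0 : ((k : ℝ) * L) ^ d ≠ 0 := pow_ne_zero _ (mul_ne_zero (by exact_mod_cast (by omega : k ≠ 0)) (by exact_mod_cast (by omega : L ≠ 0)))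
    rw [div_pow]
    field_simp
  have hratio : Tendsto (fun k : ℕ => ω.boxEntropyDensity (k * L + L) * ((((k : ℝ) * L + L) / ((k : ℝ) * L)) ^ d)) atTop
      (𝓝 ω.entropyDensitySup) := by
    have h1 : Tendsto (fun k : ℕ => (((k : ℝ) * L + L) / ((k : ℝ) * L)) ^ d) atTop (𝓝 1) := by
      have : Tendsto (fun k : ℕ => 1 + (1 : ℝ) / k) atTop (𝓝 (1 + 0)) := tendsto_const_nhds.add (tendsto_const_div_atTop_nhds_zero_nat _)
      rw [add_zero] at this
      have h := this.pow d
      rw [one_pow] at h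
      refine h.congr' ?_
      filter_upwards [Filter.eventually_ge_atTop 1] with k hk
      have hk0 : (k : ℝ) ≠ 0 := by exact_mod_cast (by omega : k ≠ 0)
      have hL0 : (L : ℝ) ≠ 0 := by exact_mod_cast (by omega : L ≠ 0)
      congr 1
      field_simp
    have h := hlimω.mul h1
    rwa [mul_one] at h
  -- pointwise for `k ≥ 1`: `S(ω̄|[0,kL)^d)/(kL)^d ≥ S(ω|[0,kL+L)^d)/(kL)^d − corr`
  have hkey := hratio.sub hcorr
  rw [sub_zero] at hkey
  refine le_of_tendsto_of_tendsto hkey hlimA ?_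
  filter_upwards [Filter.eventually_ge_atTop 1] with k hk
  have hkL : (0 : ℝ) < ((k : ℝ) * L) ^ d := by positivity
  have hkL' : (0 : ℝ) < ((k * L + L : ℕ) : ℝ) ^ d := by positivity
  -- concavity over the cell average
  have hconc : (Fintype.card (Cell q) : ℝ)⁻¹ * ∑ c : Cell q, vonNeumannEntropy ((ω.shift (cellPos c)).rdm (halfOpenBox d (k * L))) ≤
      vonNeumannEntropy ((ω.cellAverage q).rdm (halfOpenBox d (k * L))) := by
    have hN : (Fintype.card (Cell q) : ℝ) ≠ 0 := Nat.cast_ne_zero.2 Fintype.card_ne_zero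
    have hp1 : ∑ _c : Cell q, (Fintype.card (Cell q) : ℝ)⁻¹ = 1 := by
      rw [Finset.sum_const, Finset.card_univ, nsmul_eq_mul, mul_inv_cancel₀ hN]
    have hdns : ∀ c : Cell q, Literature.Computability.QuantumComplexity.IsDensity ((ω.shift (cellPos c)).rdm (halfOpenBox d (k * L))) :=
      fun c => ⟨(ω.shift (cellPos c)).rdm_posSemidef _, (ω.shift (cellPos c)).trace_rdm _⟩
    have h := vonNeumannEntropy_convexComb_ge (fun _ : Cell q => (Fintype.card (Cell q) : ℝ)⁻¹) (fun _ => inv_nonneg.2 (Nat.cast_nonneg _))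
      hp1 (fun c => (ω.shift (cellPos c)).rdm (halfOpenBox d (k * L))) hdns
    rw [← Finset.mul_sum] at h
    have hrdm : (ω.cellAverage q).rdm (halfOpenBox d (k * L)) =
        ∑ c : Cell q, ((((Fintype.card (Cell q) : ℝ)⁻¹ : ℝ)) : ℂ) • (ω.shift (cellPos c)).rdm (halfOpenBox d (k * L)) := by
      ext s t
      simp only [InfVolFermionState.rdm_apply, InfVolFermionState.cellAverage, InfVolFermionState.shiftAverage_expect, Matrix.sum_apply,
        Matrix.smul_apply, smul_eq_mul, Finset.mul_sum]
    rw [hrdm]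
    exact h
  -- each translate: `S(ω|[0,kL)^d + pos c) ≥ S(ω|[0,kL+L)^d) − corr`
  have hterm : ∀ c : Cell q, vonNeumannEntropy (ω.rdm (halfOpenBox d (k * L + L))) -
      (((k : ℝ) * L + L) ^ d - ((k : ℝ) * L) ^ d) * Real.log 4 ≤ vonNeumannEntropy ((ω.shift (cellPos c)).rdm (halfOpenBox d (k * L))) := by
    intro c
    rw [vonNeumannEntropy_rdm_shift]
    have h := hω.vonNeumannEntropy_rdm_shiftSet_cellPos_ge hd c (k * L)
    rw [← hL] at h
    push_cast at h
    exact h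
  have hN : (Fintype.card (Cell q) : ℝ) ≠ 0 := Nat.cast_ne_zero.2 Fintype.card_ne_zero
  have havg : vonNeumannEntropy (ω.rdm (halfOpenBox d (k * L + L))) - (((k : ℝ) * L + L) ^ d - ((k : ℝ) * L) ^ d) * Real.log 4 ≤
      (Fintype.card (Cell q) : ℝ)⁻¹ * ∑ c : Cell q, vonNeumannEntropy ((ω.shift (cellPos c)).rdm (halfOpenBox d (k * L))) := by
    calc _ = (Fintype.card (Cell q) : ℝ)⁻¹ * ∑ _c : Cell q, (vonNeumannEntropy (ω.rdm (halfOpenBox d (k * L + L))) -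
            (((k : ℝ) * L + L) ^ d - ((k : ℝ) * L) ^ d) * Real.log 4) := by
          rw [Finset.sum_const, Finset.card_univ, nsmul_eq_mul, ← mul_assoc, inv_mul_cancel₀ hN, one_mul]
      _ ≤ _ := mul_le_mul_of_nonneg_left (Finset.sum_le_sum fun c _ => hterm c) (inv_nonneg.2 (Nat.cast_nonneg _))
  -- divide by `(kL)^d`
  rw [boxEntropyDensity_apply, boxEntropyDensity_apply]
  have e1 : vonNeumannEntropy (ω.rdm (halfOpenBox d (k * L + L))) / ((k * L + L : ℕ) : ℝ) ^ d * (((k : ℝ) * L + L) / ((k : ℝ) * L)) ^ d -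
      (((k : ℝ) * L + L) ^ d - ((k : ℝ) * L) ^ d) * Real.log 4 / ((k : ℝ) * L) ^ d =
      (vonNeumannEntropy (ω.rdm (halfOpenBox d (k * L + L))) - (((k : ℝ) * L + L) ^ d - ((k : ℝ) * L) ^ d) * Real.log 4) /
        ((k : ℝ) * L) ^ d := by
    push_cast
    rw [div_pow]
    field_simp
  rw [e1, div_le_iff₀ hkL]
  have e2 : vonNeumannEntropy ((ω.cellAverage q).rdm (halfOpenBox d (k * L))) / ((k * L : ℕ) : ℝ) ^ d * ((k : ℝ) * L) ^ d =
      vonNeumannEntropy ((ω.cellAverage q).rdm (halfOpenBox d (k * L))) := by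
    push_cast
    field_simp
  rw [e2]
  exact havg.trans hconc

/-- **CONSISTENCY: for a translation-COVARIANT interaction the periodic and the translation-invariant variational pressures coincide**,
`P_q(β,Ψ) = P(β,Ψ)` for every `q` (`d ≥ 1`). [cite: Israel1979, Thm. I.2.4] [cite: BratteliRobinsonII1997, Thm. 6.2.40] -/
theorem _root_.Literature.MathematicalPhysics.QuantumLattice.FermionInteraction.perVarPressure_eq_varPressure (hd : 0 < d) (β : ℝ) (q : Fin d → ℕ)
    {Ψ : FermionInteraction d} (hT : Ψ.IsTranslationInvariant) (R : ℝ) : Ψ.perVarPressure β q R = Ψ.varPressure β R := by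
  refine le_antisymm (Ψ.perVarPressure_le β q R fun ω hω => ?_) (Ψ.varPressure_le β R fun ω hω => ?_)
  · -- the cell average is a TI competitor with the same energy and not smaller entropy
    have hTI := hω.isTranslationInvariant_cellAverage
    have h := Ψ.sub_mul_le_varPressure β R hTI
    rw [← cellMeanEnergy_eq_meanEnergy_cellAverage hT] at h
    have hs := hω.entropyDensitySup_le_cellAverage hd
    rcases le_or_gt 0 β with hb | hb <;> linarith
  · have h := Ψ.sub_mul_le_perVarPressure β q R (hω.isPeriodic q)
    rwa [hω.cellMeanEnergy_eq hT] at h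

end InfVolFermionState

end Literature.MathematicalPhysics.QuantumLattice

end
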